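import Literature.AlgebraicGeometry.Resolution.ProperModelsRegModel
import Literature.AlgebraicGeometry.Resolution.ProperModelsFunctionField
import Literature.AlgebraicGeometry.Resolution.ResolutionLU
import Literature.AlgebraicGeometry.Resolution.ZariskiPatchingGlue
import HarnessLib

/-!
# Stub `stub_isLocallyUniformizable_of_regModelAt`
# (crux stmt-ResolutionOfSingularities-0552, line `Sketch` rev. c6)

Glue stub of the skeleton `Sketch` (rev. c6) for the crux `PalterationThesis`
(stmt-ResolutionOfSingularities-0552): **a regular proper model uniformizes every valuation.**
Over ONE field `K` (no characteristic or perfectness hypothesis), the rev. c6 residue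
`RegModel_K` — every `F/K` essentially of finite type having a proper model has a REGULAR proper
model — gives LOCAL UNIFORMIZATION over `K`: every valuation ring `O ∋ K` of a finitely generated
`F/K` contains a finitely generated `K`-subalgebra `T` with `Frac T = F` whose localisation at the
centre `𝔪_O ∩ T` is regular (`IsLocallyUniformizable K F O`).

Proof. `F/K` finitely generated has an affine model inside `O` (`exists_affineModel`), hence a
projective model (`ProjModel.nonempty_of_fg`), hence by `RegModel_K` a regular proper model `N`.
The valuative criterion of properness centres `O` on `N` (`ProperModel.isCentre_centre`): a
`K`-morphism `l : Spec O → N` restricting to the `F`-point `gen_N` on `Spec F`; its centre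
`x = l(𝔪_O)` has a regular local ring. The induced local homomorphism `ψ : 𝒪_{N,x} → O` followed by
`O ⊆ F` is the canonical embedding `𝒪_{N,x} → K(N) ≅ F` (`algebraMap_stalkClosedPointTo_eq`: both
induce `gen_N` after `Spec (-) → Spec 𝒪_{N,x} → N`, a monomorphism), so `ψ` is injective. An affine
neighbourhood `V = Spec B ∋ x` is of finite type over `K`; `T :=` the image of
`B → 𝒪_{N,x} → O ⊆ F` is a finitely generated `K`-subalgebra of `O`, equal to the image of
`B → K(N) ≅ F`, so `Frac T = F` (`K(N) = Frac B`); and `𝒪_{N,x} = B_𝔮 → T_{𝔪_O ∩ T}` is bijective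
(`𝔮 =` the prime of `x =` the preimage of `𝔪_O`), so `T_{𝔪_O ∩ T}` is regular
(`isLocallyUniformizable_of_regCentre`, the chart extraction of
`exists_fg_regular_of_hasResolution` in `ResolutionLU.lean` run on a proper model over `Spec K`
instead of a resolution over `Spec A`).
-/

set_option linter.dupNamespace false

noncomputable section

open CategoryTheory AlgebraicGeometry IsLocalRing
open Literature.AlgebraicGeometry.Resolution

namespace Summit.ResolutionOfSingularities.ResolutionOfSingularities.Theorems.PalterationThesis.ZariskiPerfect

universe u

/-- **The local homomorphism of a lift is the canonical embedding into `K`.** For a proper model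
`N` of `K/k`, a valuation ring `𝒪_v ∈ Zar(K/k)` and a morphism `l : Spec 𝒪_v → N` restricting to
the `K`-point `gen_N` on `Spec K`, the local homomorphism `𝒪_{N,l(𝔪_v)} → 𝒪_v`
(`Scheme.stalkClosedPointTo l`) followed by `𝒪_v ⊆ K` equals `𝒪_{N,l(𝔪_v)} → K(N) ≅ K`: both ring
maps `u` satisfy `Spec u ≫ (Spec 𝒪_{N,x} → N) = gen_N`, and `Spec 𝒪_{N,x} → N` is a monomorphism
(adapted from `ProjModel.isCentreOf_of_lift`, `ProjectiveModelsCentresLocal.lean`). [folklore] -/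
theorem algebraMap_stalkClosedPointTo_eq {k K : Type u} [Field k] [Field K] [Algebra k K]
    (N : ProperModel k K) (v : ZariskiRiemannSpace k K)
    (l : Spec (.of v.asValuationSubring) ⟶ N.X) (hl : KModel.specKTo v ≫ l = N.gen)
    (t : N.X.presheaf.stalk (l (closedPoint v.asValuationSubring))) :
    (((Scheme.stalkClosedPointTo l).hom t : v.asValuationSubring) : K) =
      N.funFieldIso.hom.hom
        (algebraMap (N.X.presheaf.stalk (l (closedPoint v.asValuationSubring)))
          N.X.functionField t) := by
  -- adapted from `ProjModel.isCentreOf_of_lift` / `ProjModel.eq_stalkToK_of_specMap_comp`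
  let φ := Scheme.stalkClosedPointTo l
  let u₁ : N.X.presheaf.stalk (l (closedPoint v.asValuationSubring)) →+* K :=
    (algebraMap v.asValuationSubring K).comp φ.hom
  let u₂ : N.X.presheaf.stalk (l (closedPoint v.asValuationSubring)) →+* K :=
    N.funFieldIso.hom.hom.comp
      (algebraMap (N.X.presheaf.stalk (l (closedPoint v.asValuationSubring))) N.X.functionField)
  have hl' : Spec.map (CommRingCat.ofHom (algebraMap v.asValuationSubring K)) ≫ l = N.gen := hl
  have h₁ : Spec.map (CommRingCat.ofHom u₁) ≫
      N.X.fromSpecStalk (l (closedPoint v.asValuationSubring)) = N.gen := by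
    rw [show CommRingCat.ofHom u₁ =
        φ ≫ CommRingCat.ofHom (algebraMap v.asValuationSubring K) from rfl,
      Spec.map_comp, Category.assoc, Scheme.Spec_stalkClosedPointTo_fromSpecStalk, hl']
  have h₂ : Spec.map (CommRingCat.ofHom u₂) ≫
      N.X.fromSpecStalk (l (closedPoint v.asValuationSubring)) = N.gen := by
    rw [show CommRingCat.ofHom u₂ = N.X.presheaf.stalkSpecializes
        ((genericPoint_spec N.X).specializes trivial) ≫ N.funFieldIso.hom from rfl,
      Spec.map_comp, Category.assoc, Scheme.SpecMap_stalkSpecializes_fromSpecStalk,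
      ProperModel.specMap_funFieldIso_hom_fromSpecStalk]
  have h : u₁ = u₂ := by
    have e : Spec.map (CommRingCat.ofHom u₁) = Spec.map (CommRingCat.ofHom u₂) := by
      rw [← cancel_mono (N.X.fromSpecStalk (l (closedPoint v.asValuationSubring))), h₁, h₂]
    exact congrArg CommRingCat.Hom.hom (Spec.map_injective e)
  change u₁ t = u₂ t
  exact RingHom.congr_fun h t

/-- **A regular centre on a proper model uniformizes the valuation** (Zariski: "`v` has a simple
centre on the model"; the passage from a proper model to an affine uniformizing model of
Piltant 2013, Axiom 5 / Zariski–Samuel II, Ch. VI §17). If the centre `x` of `𝒪_v ∈ Zar(K/k)` on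
a proper model `N` of `K/k` has a regular local ring, then `𝒪_v` is locally uniformizable over
`k`: an affine neighbourhood `Spec B ∋ x` is of finite type over `k`, the image `T` of
`B → 𝒪_{N,x} → 𝒪_v ⊆ K` is a finitely generated `k`-subalgebra of `𝒪_v` with `Frac T = K`
(it is the image of `B → K(N) ≅ K`, `algebraMap_stalkClosedPointTo_eq`), and
`T_{𝔪_v ∩ T} ≅ B_𝔮 = 𝒪_{N,x}` is regular (adapted from `exists_fg_regular_of_hasResolution`,
`ResolutionLU.lean`). [folklore] -/
theorem isLocallyUniformizable_of_regCentre {k K : Type u} [Field k] [Field K]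
    [Algebra k K] (N : ProperModel k K) (v : ZariskiRiemannSpace k K) (hv : N.RegCentre v) :
    IsLocallyUniformizable k K v.asValuationSubring := by
  classical
  -- adapted from `exists_fg_regular_of_hasResolution` (ResolutionLU.lean)
  obtain ⟨l, hl₁, hl₂, hlx⟩ := N.isCentre_centre v
  set c : Spec (.of v.asValuationSubring) := closedPoint v.asValuationSubring with hc
  -- the centre `x = l(𝔪_v)` and its regular local ring
  haveI hregx : IsRegularLocalRing (N.X.presheaf.stalk (l c)) := by
    rw [hlx]; exact hv
  let ψ := Scheme.stalkClosedPointTo l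
  -- `ψ : 𝒪_{N,x} → 𝒪_v` followed by `𝒪_v ⊆ K` is `𝒪_{N,x} → K(N) ≅ K`; hence `ψ` is injective
  have hval : ∀ t, ((ψ.hom t : v.asValuationSubring) : K) =
      N.funFieldIso.hom.hom (algebraMap (N.X.presheaf.stalk (l c)) N.X.functionField t) :=
    algebraMap_stalkClosedPointTo_eq N v l hl₁
  have hψ : Function.Injective ψ := by
    intro a b h
    have h' : ((ψ.hom a : v.asValuationSubring) : K) = ((ψ.hom b : v.asValuationSubring) : K) :=
      congrArg (fun z : v.asValuationSubring => (z : K)) h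
    rw [hval, hval] at h'
    exact IsFractionRing.injective (N.X.presheaf.stalk (l c)) N.X.functionField
      (N.funFieldIso.commRingCatIsoToRingEquiv.injective h')
  -- an affine neighbourhood `V ∋ x`, of finite type over `k`
  obtain ⟨_, ⟨V, hV : IsAffineOpen V, rfl⟩, hxV, -⟩ :=
    N.X.isBasis_affineOpens.exists_subset_of_mem_open (Set.mem_univ (l c)) isOpen_univ
  haveI : Nonempty V := ⟨⟨l c, hxV⟩⟩
  have hft : (N.π.appLE ⊤ V le_top).hom.FiniteType :=
    HasRingHomProperty.appLE (P := @LocallyOfFiniteType) N.π inferInstance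
      ⟨⊤, isAffineOpen_top _⟩ ⟨V, hV⟩ le_top
  let α : k →+* Γ(N.X, V) := (N.π.appLE ⊤ V le_top).hom.comp (Scheme.ΓSpecIso (.of k)).inv.hom
  have hα : α.FiniteType :=
    hft.comp (RingHom.FiniteType.of_surjective _
      (Scheme.ΓSpecIso (.of k)).symm.commRingCatIsoToRingEquiv.surjective)
  let β : Γ(N.X, V) →+* v.asValuationSubring := ψ.hom.comp (N.X.presheaf.germ V (l c) hxV).hom
  -- compatibility `β ∘ α = (k → 𝒪_v)`
  let φ₀ : k →+* v.asValuationSubring := KModel.toValuationSubringHom v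
  have hl₂' : l ≫ N.π = Spec.map (CommRingCat.ofHom φ₀) := hl₂
  have key1 : N.π.appLE ⊤ V le_top ≫ N.X.presheaf.germ V (l c) hxV =
      (Spec (.of k)).presheaf.germ ⊤ (N.π (l c)) trivial ≫ N.π.stalkMap (l c) := by
    rw [Scheme.Hom.germ_stalkMap, Scheme.Hom.appLE, Category.assoc, TopCat.Presheaf.germ_res]
  have key2 : (Spec (.of k)).presheaf.germ ⊤ ((l ≫ N.π) c) trivial ≫
      Scheme.stalkClosedPointTo (l ≫ N.π) =
        (Scheme.ΓSpecIso (.of k)).hom ≫ CommRingCat.ofHom φ₀ := by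
    rw [germ_stalkClosedPointTo_congr hl₂' ⊤ trivial]
    exact Scheme.germ_stalkClosedPointTo_Spec (CommRingCat.ofHom φ₀)
  have key3 : (Spec (.of k)).presheaf.germ ⊤ (N.π (l c)) trivial ≫ N.π.stalkMap (l c) ≫ ψ =
      (Scheme.ΓSpecIso (.of k)).hom ≫ CommRingCat.ofHom φ₀ := by
    rw [← key2, Scheme.stalkClosedPointTo_comp]
    rfl
  have key : (Scheme.ΓSpecIso (.of k)).inv ≫ N.π.appLE ⊤ V le_top ≫
      N.X.presheaf.germ V (l c) hxV ≫ ψ = CommRingCat.ofHom φ₀ := by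
    rw [← Category.assoc (N.π.appLE ⊤ V le_top), key1, Category.assoc, key3,
      Iso.inv_hom_id_assoc]
  have hβα : ∀ a, β (α a) = φ₀ a := fun a => by
    have := ConcreteCategory.congr_hom key a
    simp only [CategoryTheory.comp_apply, CommRingCat.hom_ofHom] at this
    exact this
  -- the prime of `Γ(N, V)` at `x` is the preimage of `𝔪_v`
  letI algx := N.X.presheaf.algebra_section_stalk (⟨l c, hxV⟩ : V)
  have hlocx := hV.isLocalization_stalk ⟨l c, hxV⟩
  set 𝔮 := (hV.primeIdealOf ⟨l c, hxV⟩).asIdeal with h𝔮def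
  have h𝔮 : 𝔮 = Ideal.comap β (maximalIdeal v.asValuationSubring) := by
    rw [h𝔮def, IsAffineOpen.primeIdealOf_eq_map_closedPoint, Spec.map_apply,
      PrimeSpectrum.comap_asIdeal]
    change Ideal.comap (N.X.presheaf.germ V (l c) hxV).hom (maximalIdeal _) =
      Ideal.comap (ψ.hom.comp (N.X.presheaf.germ V (l c) hxV).hom) (maximalIdeal _)
    rw [← Ideal.comap_comap, IsLocalRing.maximalIdeal_comap ψ.hom]
  -- the uniformizing algebra `T = image of Γ(N, V)` in `K`
  letI : Algebra k Γ(N.X, V) := α.toAlgebra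
  haveI : Algebra.FiniteType k Γ(N.X, V) := hα
  let γ : Γ(N.X, V) →ₐ[k] K :=
    { (algebraMap v.asValuationSubring K).comp β with
      commutes' := fun a => by
        change algebraMap v.asValuationSubring K (β (α a)) = algebraMap k K a
        rw [hβα]; rfl }
  -- `γ` is `Γ(N, V) → K(N) ≅ K`
  have hγ : ∀ b : Γ(N.X, V), γ b = N.funFieldIso.hom.hom (N.X.germToFunctionField V b) := by
    intro b
    change ((ψ.hom (N.X.presheaf.germ V (l c) hxV b) : v.asValuationSubring) : K) = _
    rw [hval, Scheme.algebraMap_germ_eq_germToFunctionField]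
  let T : Subalgebra k K := γ.range
  have hTfg : T.FG := by
    change (γ.range).FG
    rw [← Algebra.map_top]; exact Subalgebra.FG.map _ Algebra.FiniteType.out
  have hTO : T.toSubring ≤ v.asValuationSubring.toSubring := by
    rintro _ ⟨b, rfl⟩; exact (β b).2
  -- `Frac T = K`, since `K(N) = Frac Γ(N, V)`
  haveI : IsFractionRing Γ(N.X, V) N.X.functionField :=
    functionField_isFractionRing_of_isAffineOpen N.X V hV
  have hTfr : IsFractionRing T K := by
    refine IsFractionRing.of_field T K fun z => ?_
    obtain ⟨a, b, -, hab⟩ :=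
      IsFractionRing.div_surjective (A := Γ(N.X, V)) (N.funFieldIso.inv.hom z)
    refine ⟨⟨γ a, a, rfl⟩, ⟨γ b, b, rfl⟩, ?_⟩
    change z = γ a / γ b
    rw [hγ, hγ, ← map_div₀]
    change z = N.funFieldIso.hom.hom (algebraMap _ _ a / algebraMap _ _ b)
    rw [hab, ← CommRingCat.comp_apply, Iso.inv_hom_id, CommRingCat.id_apply]
  refine ⟨T, hTO, hTfg, hTfr, ?_⟩
  -- `𝒪_{N,x} = Γ(N, V)_𝔮 → T_{𝔪_v ∩ T}` is bijective
  set P := Ideal.comap (Subring.inclusion hTO) (maximalIdeal v.asValuationSubring) with hP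
  let γ' : Γ(N.X, V) →+* T := γ.rangeRestrict.toRingHom
  have hγ' : ∀ b, ((γ' b : T) : K) = (β b : K) := fun b => rfl
  have hγ'sur : Function.Surjective γ' := AlgHom.rangeRestrict_surjective γ
  have hPq : Ideal.comap γ' P = 𝔮 := by
    ext b
    rw [h𝔮]
    change Subring.inclusion hTO (γ' b) ∈ maximalIdeal v.asValuationSubring ↔
      β b ∈ maximalIdeal v.asValuationSubring
    rw [show Subring.inclusion hTO (γ' b) = β b from Subtype.ext rfl]
  have hMle : 𝔮.primeCompl ≤ P.primeCompl.comap γ' := fun b hb hb' => hb (by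
    rw [← hPq]; exact hb')
  let δ : N.X.presheaf.stalk (l c) →+* Localization.AtPrime P :=
    IsLocalization.map (Localization.AtPrime P) γ' hMle
  have hδsurj : Function.Surjective δ := by
    intro z
    obtain ⟨t, u, rfl⟩ := IsLocalization.exists_mk'_eq P.primeCompl z
    obtain ⟨b, rfl⟩ := hγ'sur t
    obtain ⟨s, hs⟩ := hγ'sur u
    have hsq : s ∉ 𝔮 := by
      intro hs𝔮
      rw [← hPq, Ideal.mem_comap, hs] at hs𝔮
      exact u.2 hs𝔮
    refine ⟨IsLocalization.mk' _ b (⟨s, hsq⟩ : 𝔮.primeCompl), ?_⟩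
    rw [IsLocalization.map_mk']
    congr 1
    exact Subtype.ext hs
  have hδinj : Function.Injective δ := by
    rw [injective_iff_map_eq_zero]
    intro z hz
    obtain ⟨b, s, rfl⟩ := IsLocalization.exists_mk'_eq 𝔮.primeCompl z
    rw [IsLocalization.map_mk', IsLocalization.mk'_eq_zero_iff] at hz
    obtain ⟨⟨m, hm⟩, hmb⟩ := hz
    have hm0 : m ≠ 0 := fun h => hm (by rw [h]; exact P.zero_mem)
    have hb0 : γ' b = 0 := (mul_eq_zero.mp hmb).resolve_left hm0
    have hβb : β b = 0 := by
      have h1 : ((γ' b : T) : K) = 0 := by rw [hb0]; rfl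
      rw [hγ'] at h1
      exact_mod_cast h1
    have hgerm : N.X.presheaf.germ V (l c) hxV b = 0 :=
      hψ (by rw [map_zero]; exact hβb)
    rw [IsLocalization.mk'_eq_mul_mk'_one]
    change N.X.presheaf.germ V (l c) hxV b * _ = 0
    rw [hgerm, zero_mul]
  exact IsRegularLocalRing.of_ringEquiv (RingEquiv.ofBijective δ ⟨hδinj, hδsurj⟩)

/-- **GLUE STUB `stub_isLocallyUniformizable_of_regModelAt` (worker B, certification: rev. c6
dominates rev. c5).** Over a field `K`, the existence of regular proper models of every function
field `F/K` having a proper model (`RegModel_K`) gives LOCAL UNIFORMIZATION of every valuation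
ring `O ∋ K` of every finitely generated `F/K`: `F/K` has an affine model inside `O`
(`exists_affineModel`), hence a projective model (`ProjModel.nonempty_of_fg`), hence a regular
proper model `N`; the centre of `O` on `N` is a regular point, and an affine chart around it is a
finitely generated model of `F` inside `O`, regular at the centre
(`isLocallyUniformizable_of_regCentre`). In particular `RegModel_K` implies both
valuation atoms `Temkin_K` (with `L = F`) and `RRLU1_K` of rev. c3–c5. [folklore] -/
theorem stub_isLocallyUniformizable_of_regModelAt (K : Type) [Field K]
    (hR : ∀ (F : Type) [Field F] [Algebra K F] [Algebra.EssFiniteType K F],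
      Nonempty (ProperModel K F) → ∃ N : ProperModel K F, Scheme.IsRegular N.X)
    (F : Type) [Field F] [Algebra K F] (hFfg : (⊤ : IntermediateField K F).FG)
    (O : ValuationSubring F) (hO : ∀ c : K, algebraMap K F c ∈ O) :
    IsLocallyUniformizable K F O := by
  haveI : Algebra.EssFiniteType K F := IntermediateField.fg_top_iff.mp hFfg
  obtain ⟨A₀, -, hA₀fg, hA₀fr⟩ := exists_affineModel K F hFfg O hO
  haveI := hA₀fr
  obtain ⟨M₀⟩ := ProjModel.nonempty_of_fg A₀ hA₀fg
  obtain ⟨N, hN⟩ := hR F ⟨M₀.toProperModel⟩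
  let v : ZariskiRiemannSpace K F := ⟨O, hO⟩
  exact isLocallyUniformizable_of_regCentre N v (hN _)

end Summit.ResolutionOfSingularities.ResolutionOfSingularities.Theorems.PalterationThesis.ZariskiPerfect

end
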